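import Literature.AnabelianGeometry.AbsoluteAnabelian.AbsTopIII.Thm19Steps
import HarnessLib

/-!
# [AbsTopIII] Thm. 1.9, step (d): the Kummer containers `k̄_NF^× ⊆ K_{Z_NF}^× ↪ lim_{→V} H¹(Π_V, μ_Ẑ(Π_U))`

Mochizuki, *Topics in Absolute Anabelian Geometry III*, §1, Theorem 1.9 (d), manuscript pp. 37–38
(lit key `paper:url-5493eb38cbb7`): "For `U ⊆ Y ⊆ Z`, `k_Z` as in (b), one constructs the subgroups
`k̄_NF^× ⊆ K_{Z_NF}^× ↪ lim_{→V} H¹(Π_V, μ_Ẑ(Π_U))` — where `V` ranges over the open subschemes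
obtained by removing finite collections of NF-points from `Z ×_{k_Z} k′`, for `k′` a finite extension
of `k_Z`; `Π_V := π₁(V)`; `K_{Z_NF}` is the function field of the curve `Z_NF` obtained by descending
`Z ×_{k_Z} k̄` to `k̄_NF`; the '`↪`' arises from the Kummer map — via the subgroups of (c) and the
characterizations of Kummer classes of nonconstant NF-rational functions and NF-constants given in
Proposition 1.8, (i), (ii) [cf. also the decomposition groups of (a)]."

Sub-DAG `plan/L4/SUBDAG-AbsTopIII-Thm19.md`, rows Thm19.d.r7–r10 (cell abc-iut, D-0068 (1)); sibling
of `Thm19Steps.lean` (step (a) and the `H¹` bookkeeping used here).  abc-iut-L4-t1's `Reconstruction.lean`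
records the Kummer containers as NOT typed ("needs directed system of NF-point complements"); this file
supplies, relative to a model `M : IntrinsicKummerModel` (typing policy θ):

* `CurveModel.NFComplementSystem M Z ι` — the DIRECTED SYSTEM of the text as interface data: levels
  `V i ⊆ Z ×_{k_Z} k′_i` (cofinite opens of base changes `Zb i` of `Z`, the base-change legs
  `Π_{Z ×_{k_Z} k′} → Π_Z` typed by `Hom.IsBaseChange` + `Hom.IsOpenInjective`), transition
  homomorphisms over `Π_Z`, the printed clauses ("removing [...] NF-points", cusps rational over `k′`,
  `V` an NF-curve) and two COFINALITY clauses ("`V` RANGES OVER [all such]": every NF-point is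
  eventually removed; the base fields `k′` are eventually inside any open subgroup of `G_{k_i}`);
* `NFComplementSystem.kummerContainer` — **`lim_{→V} H¹(Π_V, M_Z)`**, Mathlib's
  `AddCommGroup.DirectLimit` of the REAL `cyclotomeModH1` along the pull-backs `cyclotomeModH1Pull`
  (coefficients `μ_Ẑ(Π_U) := M_Z = Hom(H²(Δ_Z, Ẑ), Ẑ)` fixed, `Π_V` acting through `Π_V → Π_Z`);
* `IntrinsicKummerModel.NFComplementSystem.kummerToContainer` — the Kummer map of level `i`
  (abc-iut-L4-t1's `kummerMap`, coefficients `M_{Z ×_{k_Z} k′}`) pushed to coefficients `M_Z` along the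
  base-change leg (`cyclotomeModH1Push`) and into the limit ("the '`↪`' arises from the Kummer map");
* the criteria of Prop. 1.8 (i), (ii) as predicates on classes (`IsNonconstNFClass`, `IsNFConstClass`,
  using the level subgroups `P_V` of step (c) in abc-iut-L4-t1's model-relative form `PU`), the parts
  `functionFieldPart` ("`K_{Z_NF}^×`") and `constantPart` ("`k̄_NF^×`") of the container they cut out,
  and the NAMED comparison statements `Thm19d_inj`, `Thm19d_functionField`, `Thm19d_constants`.

No new Prop FACT: the cited results (Prop. 1.6 (i), Prop. 1.8 (i)(ii)) are abc-iut-L4-t1's named facts;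
the new `def … : Prop` are the printed intermediate statements of Thm. 1.9 (d) relative to `M`.
HONEST FRAMING: statements-first; typed ≠ proved; nothing here bears on [IUTchIII] Cor. 3.12.

DELTA TO PRINT (abc-iut referee finding N-B14-2, referee-abc-iut-ref-b, 2026-08-26; recorded, statements
unchanged): print PINS the embedding — "the '`↪`' arises from the Kummer map" (p. 37/38) — whereas
`Thm19d_functionField` / `Thm19d_constants` ask only for SOME injective homomorphism `e` from `K_{Z_NF}^×`
(resp. `k̄_NF^×`) with image the Prop.-1.8-certified part (= the set of Kummer classes of NF-rational
units / NF-constants of the levels, first conjunct).  The pinned form "`e ∘` (unit of a level) `=` the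
Kummer map of that level" cannot be STATED over this interface: `CurveModel` carries no map between the
abstract field `NFFunctionField Z` (resp. `kbarNF Z`) and the function fields (resp. base fields) of the
levels.  It IS stated and proved over the successor data that supply these maps — the per-system tower
`IntrinsicKummerModel.NFTower` (`Thm19KummerTower.lean`): the embeddings constructed in
`Thm19KummerContainerEmbeddingProofs.lean` / `Thm19KummerTowerProofs.lean` are Kummer-induced by
construction (`e a = kummerToContainer S j f` whenever `f` represents `a` at level `j`).
-/

noncomputable section

open CategoryTheory
open scoped Classical Pointwise

namespace Literature.AnabelianGeometry.AbsoluteAnabelian.AbsTopIII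

universe u

/-! ### The directed system "`V` ranges over ..." as interface data -/

namespace CurveModel

/-- **The directed system of Thm. 1.9 (d)** over a proper curve `Z` of the model ("`V` ranges over the
open subschemes obtained by removing finite collections of NF-points from `Z ×_{k_Z} k′`, for `k′` a
finite extension of `k_Z`", p. 37): INTERFACE DATA (the intended instance is the system of ALL such `V`
with their natural morphisms; `CurveModel` has no base-change relation, so the base-change legs are
recorded by their group-theoretic shadow `Hom.IsBaseChange` ∧ `Hom.IsOpenInjective`), over an index
preorder `ι` (a parameter; directed and nonempty in the statements below).  Fields: the base changes `Zb i = Z ×_{k_Z} k′_i` with `bc i : Π_{Zb i} → Π_Z`;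
the levels `V i ⊆ Zb i` (cofinite opens removing NF-points only, all cusps rational over `k′_i`,
NF-curves over sub-`p`-adic fields); transition homomorphisms `Π_{V_j} → Π_{V_i}` over `Π_Z` for
`i ≤ j`, functorial, with open image; COFINALITY: every NF-point of every `V i` is eventually removed,
and the Galois parts shrink below every open subgroup (the `k′` exhaust `k̄`).
[cite: MochizukiAbsTopIII2015, Thm 1.9 (d) p.37] -/
structure NFComplementSystem (M : CurveModel.{u}) (Z : M.Curve) (ι : Type u) [Preorder ι] :
    Type (u + 1) where
  /-- "`Z ×_{k_Z} k′`, for `k′` a finite extension of `k_Z`" at index `i` -/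
  Zb : ι → M.Curve
  /-- "`V` [...] obtained by removing finite collections of NF-points from `Z ×_{k_Z} k′`" -/
  V : ι → M.Curve
  /-- `V i ⊆ Zb i` is a cofinite open -/
  isOpen : ∀ i, M.IsCofiniteOpen (V i) (Zb i)
  /-- `Zb i` is proper (a base change of the proper `Z`) -/
  isProper : ∀ i, M.IsProper (Zb i)
  /-- `V i` and `Zb i` are scheme-like -/
  isScheme : ∀ i, M.IsScheme (V i) ∧ M.IsScheme (Zb i)
  /-- base change preserves the genus -/
  genus_eq : ∀ i, M.genus (Zb i) = M.genus Z
  /-- "`Π_{Z ×_{k_Z} k′} → Π_Z`" -/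
  bc : ∀ i, M.ext (Zb i) ⟶ M.ext Z
  /-- it arises from a base change of the base field (`Δ ⥲ Δ`) ... -/
  isBaseChange : ∀ i, (bc i).IsBaseChange
  /-- ... to a FINITE extension `k′` (an open subgroup `G_{k′} ⊆ G_{k_Z}`, `Π_{Z_{k′}} ⊆ Π_Z` open) -/
  isOpenInjective : ∀ i, (bc i).IsOpenInjective
  /-- `V i` removes NF-points of `Zb i` only -/
  removesNF : ∀ i, M.RemovesNFPoints (isOpen i)
  /-- the removed points are rational over `k′` (as in (b): "the points of `Z ∖ U` are all rational") -/
  cuspsRational : ∀ i (c : (M.cusps (V i)).Cusp), (M.cusps (V i)).IsRational c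
  /-- `V i` is an NF-curve (Def. 1.7 (i)) -/
  isNFCurve : ∀ i, M.IsNFCurve (V i)
  /-- the base field `k′` of `V i` is sub-`p`-adic (finite over the sub-`p`-adic `k_Z`) -/
  isSubpadic : ∀ i, IsSubpadic (M.base (V i))
  /-- the transition `Π_{V_j} → Π_{V_i}` for `i ≤ j` (`V_j ⊆ V_i ×_{k′_i} k′_j`) -/
  trans : ∀ {i j : ι}, i ≤ j → (M.ext (V j) ⟶ M.ext (V i))
  /-- transitions are compatible with the maps to `Π_Z` -/
  trans_comm : ∀ {i j : ι} (h : i ≤ j), trans h ≫ (M.res (isOpen i) ≫ bc i) = M.res (isOpen j) ≫ bc j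
  /-- functoriality: identities -/
  trans_refl : ∀ i, trans (le_refl i) = 𝟙 (M.ext (V i))
  /-- functoriality: composition -/
  trans_trans : ∀ {i j k : ι} (hij : i ≤ j) (hjk : j ≤ k),
    trans (hij.trans hjk) = trans hjk ≫ trans hij
  /-- the transitions have open image (`Π_{V_j} ↠ Π_{V_i ×_{k′_i} k′_j} ⊆ Π_{V_i}` open) -/
  isOpen_range_trans : ∀ {i j : ι} (h : i ≤ j), IsOpen (Set.range (trans h).arith)
  /-- COFINALITY (points): every NF-point `x` of `V i` is removed at some level `j ≥ i` — some cusp of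
  `V j` lies over `x` (its decomposition group maps into a conjugate of `D_x`) -/
  eventually_removed : ∀ (i : ι) (x : M.Point (V i)), M.IsNFPoint (V i) x →
    ∃ (j : ι) (h : i ≤ j) (c : (M.cusps (V j)).Cusp) (g : (M.ext (V i)).arith),
      ((M.cusps (V j)).Dcusp c).map (trans h).arith.toMonoidHom ≤ MulAut.conj g • M.decomp (V i) x
  /-- COFINALITY (fields): for every open subgroup `H ⊆ G_{k′_i}` some level `j ≥ i` has `G_{k′_j}`
  mapping into `H` ("`k′` a[ny] finite extension of `k_Z`") -/
  eventually_small : ∀ (i : ι) (H : Subgroup (M.ext (V i)).gal), IsOpen (H : Set (M.ext (V i)).gal) →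
    ∃ (j : ι) (h : i ≤ j), Set.range (trans h).gal ⊆ H

namespace NFComplementSystem

variable {M : CurveModel.{u}} {Z : M.Curve} {ι : Type u} [Preorder ι] (S : NFComplementSystem M Z ι)

/-- `Π_{V_i} → Π_Z` (through `Π_{Z ×_{k_Z} k′_i}`): the homomorphism through which `Π_{V_i}` acts on
the coefficients `μ_Ẑ(Π_U) := M_Z`. [cite: MochizukiAbsTopIII2015, Thm 1.9 (d) p.37] -/
def toZ (i : ι) : M.ext (S.V i) ⟶ M.ext Z := M.res (S.isOpen i) ≫ S.bc i

/-- The level `i` of the system: **`H¹(Π_{V_i}, M_Z)`** (REAL, `cyclotomeModH1` with coefficients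
`μ_Ẑ(Π_U) := M_Z = Hom(H²(Δ_Z, Ẑ), Ẑ)`), as a type. [cite: MochizukiAbsTopIII2015, Thm 1.9 (d) p.37] -/
abbrev H1 (i : ι) : Type u := cyclotomeModH1 (S.toZ i) ZHatCoeff.{u}

/-- The arrows of the direct system: pull-back `H¹(Π_{V_i}, M_Z) → H¹(Π_{V_j}, M_Z)` along the
transition `Π_{V_j} → Π_{V_i}` (`i ≤ j`). [cite: MochizukiAbsTopIII2015, Thm 1.9 (d) p.37] -/
def transition (i j : ι) (h : i ≤ j) : S.H1 i →+ S.H1 j :=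
  (cyclotomeModH1Pull ZHatCoeff.{u} (S.trans h) (S.toZ i) (S.toZ j)
    (S.trans_comm h)).hom.toLinearMap.toAddMonoidHom

/-- **`lim_{→V} H¹(Π_V, μ_Ẑ(Π_U))`** — the Kummer container of Thm. 1.9 (d): Mathlib's direct limit of
abelian groups of the levels `H¹(Π_{V_i}, M_Z)` along the pull-backs (REAL).
[cite: MochizukiAbsTopIII2015, Thm 1.9 (d) p.37] -/
abbrev kummerContainer : Type u :=
  AddCommGroup.DirectLimit (fun i => S.H1 i) (fun i j h => S.transition i j h)

/-- The structure map `H¹(Π_{V_i}, M_Z) → lim_{→V} H¹(Π_V, M_Z)` of level `i`.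
[cite: MochizukiAbsTopIII2015, Thm 1.9 (d) p.37] -/
def toContainer (i : ι) : S.H1 i →+ S.kummerContainer :=
  AddCommGroup.DirectLimit.of (fun i => S.H1 i) (fun i j h => S.transition i j h) i

end NFComplementSystem

end CurveModel

/-! ### The Kummer maps into the container and the parts cut out by Prop. 1.8 (i), (ii) -/

namespace IntrinsicKummerModel

variable (M : IntrinsicKummerModel.{u}) {Z : M.Curve} {ι : Type u} [Preorder ι]
  (S : CurveModel.NFComplementSystem M.toCurveModel Z ι)

/-- Change of coefficients at level `i`: `H¹(Π_{V_i}, M_{Z ×_{k_Z} k′_i}) → H¹(Π_{V_i}, M_Z)` along the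
base-change leg `Π_{Z ×_{k_Z} k′_i} → Π_Z` (the identification `μ_Ẑ(Π_U) := M_Z` at level `i`), as an
additive map. [cite: MochizukiAbsTopIII2015, Thm 1.9 (d) p.37] -/
def pushToZ (i : ι) : cyclotomeModH1 (M.res (S.isOpen i)) ZHatCoeff.{u} →+ S.H1 i :=
  (cyclotomeModH1Push ZHatCoeff.{u} (M.res (S.isOpen i)) (S.bc i)).hom.toLinearMap.toAddMonoidHom

/-- The Kummer map of level `i` with coefficients `M_Z`: `Γ(V_i, 𝒪^×) → H¹(Π_{V_i}, M_Z)` (abc-iut-L4-t1's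
`κ_{V_i}` followed by `pushToZ`). [cite: MochizukiAbsTopIII2015, Thm 1.9 (d) p.38] -/
def kummerLevel (i : ι) : Additive (M.regularUnits (S.V i)) →+ S.H1 i :=
  (M.pushToZ S i).comp (M.kummerAddHom (S.isOpen i) (S.isProper i))

/-- **"the '`↪`' arises from the Kummer map"**: the Kummer map of level `i` into the container,
`Γ(V_i, 𝒪^×) → lim_{→V} H¹(Π_V, M_Z)`. [cite: MochizukiAbsTopIII2015, Thm 1.9 (d) p.38] -/
def kummerToContainer (i : ι) : Additive (M.regularUnits (S.V i)) →+ S.kummerContainer :=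
  (S.toContainer i).comp (M.kummerLevel S i)

/-- **Prop. 1.8 (i) as a predicate** on a class `η ∈ H¹(Π_{V_i}, M_{Z ×_{k_Z} k′_i})` of level `i`
("`η ∈ P_U` is the Kummer class of a nonconstant NF-rational function if and only if there exist a
positive multiple `η†` of `η` and NF-points `x₁, x₂` [...] such that `η†|_{x₁} = 0`, `η†|_{x₂} ≠ 0`",
p. 36): the right-hand side of abc-iut-L4-t1's `Prop_1_8_i`, with `P_{V_i}` in its model-relative form
`PU` (the group-theoretic reading of `P_{V_i}` through the synchronizations of (b) is sub-DAG row
Thm19.c). [cite: MochizukiAbsTopIII2015, Prop 1.8 (i) p.36] -/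
def IsNonconstNFClass (i : ι) (η : cyclotomeModH1 (M.res (S.isOpen i)) ZHatCoeff.{u}) : Prop :=
  η ∈ M.PU (S.isOpen i) (S.isProper i) ∧
    ∃ n : ℕ, 0 < n ∧ ∃ x₁ x₂ : M.Point (S.V i), M.IsNFPoint (S.V i) x₁ ∧ M.IsNFPoint (S.V i) x₂ ∧
      M.classRes (S.isOpen i) (M.decomp (S.V i) x₁) (n • η) = 0 ∧
        M.classRes (S.isOpen i) (M.decomp (S.V i) x₂) (n • η) ≠ 0

/-- **Prop. 1.8 (ii) as a predicate** on a class of level `i` ("a class `η ∈ P_U ⋂ H¹(G_k, M_X)` [...] is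
the Kummer class of an NF-constant `∈ k^×` if and only if there exist a nonconstant NF-rational function
`f ∈ Γ(U, 𝒪_U^×)` and an NF-point `x` [...] such that `κ_U(f)|_x = η|_{G_{k_x}}`", p. 36) — with "the
Kummer class of a nonconstant NF-rational function" replaced by its characterization `IsNonconstNFClass`
(Prop. 1.8 (i)), so that the predicate is phrased on classes only, and `H¹(G_k, M_X)` realised as
abc-iut-L4-t1's `galoisClasses`. [cite: MochizukiAbsTopIII2015, Prop 1.8 (ii) p.36] -/
def IsNFConstClass (i : ι) (η : cyclotomeModH1 (M.res (S.isOpen i)) ZHatCoeff.{u}) : Prop :=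
  η ∈ M.PU (S.isOpen i) (S.isProper i) ∧ η ∈ M.galoisClasses (S.isOpen i) ∧
    ∃ (θ : cyclotomeModH1 (M.res (S.isOpen i)) ZHatCoeff.{u}) (y : M.Point (S.V i)),
      M.IsNonconstNFClass S i θ ∧ M.IsNFPoint (S.V i) y ∧
        M.classRes (S.isOpen i) (M.decomp (S.V i) y) θ = M.classRes (S.isOpen i) (M.decomp (S.V i) y) η

/-- **"`K_{Z_NF}^×`" inside the container** (Thm. 1.9 (d)): the images of the level classes certified by
Prop. 1.8 (i) (nonconstant NF-rational) or (ii) (NF-constant) — "via the subgroups of (c) and the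
characterizations [...] given in Proposition 1.8, (i), (ii)".  (A subset; that it is a subgroup and is the
image of `K_{Z_NF}^×` is the statement `Thm19d_functionField`.) [cite: MochizukiAbsTopIII2015, Thm 1.9 (d) p.38] -/
def functionFieldPart : Set S.kummerContainer :=
  {ξ | ∃ (i : ι) (η : cyclotomeModH1 (M.res (S.isOpen i)) ZHatCoeff.{u}),
    (M.IsNonconstNFClass S i η ∨ M.IsNFConstClass S i η) ∧ ξ = S.toContainer i (M.pushToZ S i η)}

/-- **"`k̄_NF^×`" inside the container** (Thm. 1.9 (d)): the images of the level classes certified as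
NF-constants by Prop. 1.8 (ii). [cite: MochizukiAbsTopIII2015, Thm 1.9 (d) p.38] -/
def constantPart : Set S.kummerContainer :=
  {ξ | ∃ (i : ι) (η : cyclotomeModH1 (M.res (S.isOpen i)) ZHatCoeff.{u}),
    M.IsNFConstClass S i η ∧ ξ = S.toContainer i (M.pushToZ S i η)}

/-- MODEL side of "`K_{Z_NF}^×`": the images in the container of the Kummer classes of the NF-rational
regular units of the levels (Def. 1.7 (ii), `M.IsNFRational`). [cite: MochizukiAbsTopIII2015, Thm 1.9 (d) p.38] -/
def nfRationalImage : Set S.kummerContainer :=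
  {ξ | ∃ (i : ι) (f : M.regularUnits (S.V i)),
    M.IsNFRational (S.V i) ((f : (M.FunctionField (S.V i))ˣ) : M.FunctionField (S.V i)) ∧
      ξ = M.kummerToContainer S i (Additive.ofMul f)}

/-- MODEL side of "`k̄_NF^×`": the images in the container of the Kummer classes of the NF-constants of
the levels (Def. 1.7 (ii), `M.IsNFConstant`). [cite: MochizukiAbsTopIII2015, Thm 1.9 (d) p.38] -/
def nfConstantImage : Set S.kummerContainer :=
  {ξ | ∃ (i : ι) (c : (M.base (S.V i))ˣ)
    (hc : Units.map (algebraMap (M.base (S.V i)) (M.FunctionField (S.V i)) : _ →* _) c ∈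
      M.regularUnits (S.V i)),
    M.IsNFConstant (S.V i) (c : M.base (S.V i)) ∧ ξ = M.kummerToContainer S i (Additive.ofMul ⟨_, hc⟩)}

/-- The printed hypotheses on `Z` under which (d) is asserted ("`U ⊆ Y ⊆ Z`, `k_Z` as in (b)": `Z` the
canonical compactification of an NF-curve `Y` of genus `≥ 2`, finite étale over the Thm-1.9 input `X`
over a sub-`p`-adic field; typed for `Y = X`-type presentations, cf. `Thm_1_9_b`).
[cite: MochizukiAbsTopIII2015, Thm 1.9 (b) p.37] -/
structure IsThm19dInput (Z : M.Curve) : Prop where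
  /-- `Z` is scheme-like -/
  isScheme : M.IsScheme Z
  /-- `Z` is proper ("the canonical compactification") -/
  isProper : M.IsProper Z
  /-- "`Y` is of genus `≥ 2`" -/
  two_le_genus : 2 ≤ M.genus Z
  /-- `Z` is an NF-curve -/
  isNFCurve : M.IsNFCurve Z
  /-- the base field `k_Z` is sub-`p`-adic -/
  isSubpadic : IsSubpadic (M.base Z)

/-- **Thm. 1.9 (d), injectivity, relative to `M`** ("`K_{Z_NF}^× ↪ lim_{→V} H¹(Π_V, μ_Ẑ(Π_U))` [...] the
'`↪`' arises from the Kummer map", pp. 37–38; ⇐ Prop. 1.6 (i) at every level + injectivity of the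
transitions on Kummer classes): for every directed system of NF-complements over a (d)-input `Z`, the
Kummer map of every level into the container is injective.  NAMED statement relative to `M`.
[cite: MochizukiAbsTopIII2015, Thm 1.9 (d) p.37] -/
def Thm19d_inj (M : IntrinsicKummerModel.{u}) : Prop :=
  ∀ (Z : M.Curve), M.IsThm19dInput Z → ∀ (ι : Type u) [Preorder ι] [Nonempty ι] [IsDirectedOrder ι]
    (S : CurveModel.NFComplementSystem M.toCurveModel Z ι) (i : ι),
      Function.Injective (M.kummerToContainer S i)

/-- **Thm. 1.9 (d), "`K_{Z_NF}^×`", relative to `M`**: for every directed system of NF-complements over a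
(d)-input `Z`, the subset of the container cut out by the criteria of Prop. 1.8 (i), (ii)
(`functionFieldPart`) coincides with the set of images of Kummer classes of NF-rational regular units of
the levels (`nfRationalImage`), and it is the image of an injective homomorphism from `K_{Z_NF}^×`
("`K_{Z_NF}^× ↪ lim`"; `K_{Z_NF} = M.NFFunctionField Z`, Def. 1.7 / Thm. 1.9 (d)).  NAMED statement
relative to `M`. [cite: MochizukiAbsTopIII2015, Thm 1.9 (d) p.37] -/
def Thm19d_functionField (M : IntrinsicKummerModel.{u}) : Prop :=
  ∀ (Z : M.Curve), M.IsThm19dInput Z → ∀ (ι : Type u) [Preorder ι] [Nonempty ι] [IsDirectedOrder ι]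
    (S : CurveModel.NFComplementSystem M.toCurveModel Z ι),
    M.functionFieldPart S = M.nfRationalImage S ∧
      ∃ e : Additive (M.NFFunctionField Z)ˣ →+ S.kummerContainer,
        Function.Injective e ∧ Set.range e = M.functionFieldPart S

/-- **Thm. 1.9 (d), "`k̄_NF^×`", relative to `M`**: for every directed system of NF-complements over a
(d)-input `Z`, the subset of the container cut out by the criterion of Prop. 1.8 (ii) (`constantPart`)
coincides with the set of images of Kummer classes of NF-constants of the levels (`nfConstantImage`), and
it is the image of an injective homomorphism from `k̄_NF^×` (`M.kbarNF Z`, the algebraic closure of `ℚ`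
in `k̄`).  NAMED statement relative to `M`. [cite: MochizukiAbsTopIII2015, Thm 1.9 (d) p.37] -/
def Thm19d_constants (M : IntrinsicKummerModel.{u}) : Prop :=
  ∀ (Z : M.Curve), M.IsThm19dInput Z → ∀ (ι : Type u) [Preorder ι] [Nonempty ι] [IsDirectedOrder ι]
    (S : CurveModel.NFComplementSystem M.toCurveModel Z ι),
    M.constantPart S = M.nfConstantImage S ∧
      ∃ e : Additive (↥(M.kbarNF Z))ˣ →+ S.kummerContainer,
        Function.Injective e ∧ Set.range e = M.constantPart S

end IntrinsicKummerModel

end Literature.AnabelianGeometry.AbsoluteAnabelian.AbsTopIII
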